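import Summits.Langlands.Langlands.Theorems.PicardMuOrdinaryMuOrdinaryFamilyRTPointBorelLinAlg
import Summits.Langlands.Langlands.Theorems.PicardMuOrdinaryMuOrdinaryFamilyRTPointRing
import Literature.NumberTheory.GaloisRepresentations.AbsolutelyIrreducibleReduction

/-!
# The Picard point of line `free-seed-smooth-rt` (crux `MuOrdinaryFamilyRT`, stmt-Langlands-13757):
# frames, contragredients and `ℤ̄₃` for LEAF `modelBorel`

Helper file for the registered stub `stub_point` (plan: `…PointPlan.lean`).  All PROVED:

* `eq_combination_of_dot_eq_zero`, `frameOf`, `isUnit_det_frameOf`, **`isUpper3_conj_frameOf`** — from a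
  stable primitive vector `c₁` (`c₁(i₀) = 1`) and a covector `y` killing `c₁, c₂` (`c₂(i₀) = 0`,
  `c₂(i₁) = 1`) to the unimodular frame `(c₁, c₂, e_{i₂})` in which `R` is upper triangular;
* `trinv` (`u ↦ (u⁻¹)ᵀ` on `GL₃`), `w₀` (antidiagonal involution), `isUpper3_dualFrame`, `dualFrame_diag` —
  the contragredient of a triangularisable family is triangularised by `(g⁻¹)ᵀ w₀`, with reversed and
  inverted diagonal characters;
* `ℤ̄₃ = padicAlgClIntegers 3`: membership, maximal ideal, characteristic of the residue field,
  `algebraZModPadicAlgClResidueField` (`𝔽₃ → ℤ̄₃/𝔪̄`), `jbar : 𝒪₀ → ℤ̄₃`, `residue_jbar`;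
* `scalar_mulVec`, `IsUpper3.blockTriangular`, `mulVec_col_zero_of_isUpper3`, `eq_smul_of_cross_eq_zero`.
-/

-- `Summit.Langlands.Langlands.…` (summit = sub-problem name, D-0017 layout) trips `dupNamespace` on every decl.
set_option linter.dupNamespace false

namespace Summit.Langlands.Langlands.Cruxes.MuOrdinaryFamilyRT.FreeSeedSmoothRt

open scoped Matrix Polynomial
open Polynomial IsLocalRing
open Literature.NumberTheory.GaloisRepresentations

noncomputable section

/-! ### Adapted frames: from a stable line inside a stable plane to an upper-triangular frame -/

section Frame

variable {O : Type*} [CommRing O]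

/-- All indices of `Fin 3` are among three pairwise distinct ones. -/
theorem Fin.eq_or_eq_or_eq_of_ne {i₀ i₁ i₂ : Fin 3} (h₀₁ : i₀ ≠ i₁) (h₀₂ : i₀ ≠ i₂) (h₁₂ : i₁ ≠ i₂) (j : Fin 3) :
    j = i₀ ∨ j = i₁ ∨ j = i₂ := by
  revert i₀ i₁ i₂ j; decide

/-- **Coordinates in an adapted pair.**  Let `c₁(i₀) = 1`, `c₂(i₀) = 0`, `c₂(i₁) = 1`, and `y` a covector
killing `c₁, c₂`, `y ≠ 0`, over a domain.  Then every `z` with `y · z = 0` is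
`z = z(i₀) c₁ + (z(i₁) - z(i₀) c₁(i₁)) c₂`. -/
theorem eq_combination_of_dot_eq_zero [IsDomain O] {i₀ i₁ i₂ : Fin 3} (h₀₁ : i₀ ≠ i₁) (h₀₂ : i₀ ≠ i₂) (h₁₂ : i₁ ≠ i₂)
    (c₁ c₂ y : Fin 3 → O) (hc₁ : c₁ i₀ = 1) (hc₂₀ : c₂ i₀ = 0) (hc₂₁ : c₂ i₁ = 1) (hy : y ≠ 0)
    (hy₁ : y ⬝ᵥ c₁ = 0) (hy₂ : y ⬝ᵥ c₂ = 0) (z : Fin 3 → O) (hz : y ⬝ᵥ z = 0) :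
    z = z i₀ • c₁ + (z i₁ - z i₀ * c₁ i₁) • c₂ := by
  have hcover := Fin.eq_or_eq_or_eq_of_ne h₀₁ h₀₂ h₁₂
  -- `y(i₂) ≠ 0`
  have hsum : ∀ v : Fin 3 → O, y ⬝ᵥ v = y i₀ * v i₀ + y i₁ * v i₁ + y i₂ * v i₂ := by
    intro v
    rw [dotProduct, Fin.sum_univ_three]
    fin_cases i₀ <;> fin_cases i₁ <;> fin_cases i₂ <;> simp at h₀₁ h₀₂ h₁₂ ⊢ <;> ring
  have hy2 : y i₂ ≠ 0 := by
    intro h2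
    have e2 := hsum c₂
    rw [hy₂, hc₂₀, hc₂₁, h2] at e2
    simp only [mul_zero, zero_add, mul_one, zero_mul, add_zero] at e2
    have e1 := hsum c₁
    rw [hy₁, hc₁, ← e2, h2] at e1
    simp only [mul_one, zero_mul, add_zero] at e1
    apply hy
    ext j
    rcases hcover j with rfl | rfl | rfl
    · exact e1.symm
    · exact e2.symm
    · exact h2
  set w := z - (z i₀ • c₁ + (z i₁ - z i₀ * c₁ i₁) • c₂) with hw
  have hw0 : w i₀ = 0 := by simp [hw, hc₁, hc₂₀]
  have hw1 : w i₁ = 0 := by simp [hw, hc₂₁]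
  have hwy : y ⬝ᵥ w = 0 := by
    rw [hw, dotProduct_sub, dotProduct_add, dotProduct_smul, dotProduct_smul, hz, hy₁, hy₂]; simp
  have hw2 : w i₂ = 0 := by
    rw [hsum, hw0, hw1] at hwy
    simpa [hy2] using hwy
  have hw' : w = 0 := by
    ext j
    rcases hcover j with rfl | rfl | rfl
    · exact hw0
    · exact hw1
    · exact hw2
  rw [hw, sub_eq_zero] at hw'
  exact hw'

/-- The frame with columns `c₁, c₂, e_{i₂}`. -/
def frameOf (c₁ c₂ : Fin 3 → O) (i₂ : Fin 3) : Matrix (Fin 3) (Fin 3) O :=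
  (Matrix.of ![c₁, c₂, Pi.single i₂ 1])ᵀ

/-- The columns of `frameOf`. -/
theorem frameOf_mulVec_single (c₁ c₂ : Fin 3 → O) (i₂ : Fin 3) :
    frameOf c₁ c₂ i₂ *ᵥ Pi.single 0 1 = c₁ ∧ frameOf c₁ c₂ i₂ *ᵥ Pi.single 1 1 = c₂ := by
  constructor <;> (rw [Matrix.mulVec_single_one]; ext i; simp [frameOf])

/-- `det (frameOf c₁ c₂ i₂) = ±1` for an adapted pair. -/
theorem isUnit_det_frameOf {i₀ i₁ i₂ : Fin 3} (h₀₁ : i₀ ≠ i₁) (h₀₂ : i₀ ≠ i₂) (h₁₂ : i₁ ≠ i₂)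
    (c₁ c₂ : Fin 3 → O) (hc₁ : c₁ i₀ = 1) (hc₂₀ : c₂ i₀ = 0) (hc₂₁ : c₂ i₁ = 1) :
    IsUnit (frameOf c₁ c₂ i₂).det := by
  have key : (frameOf c₁ c₂ i₂).det = 1 ∨ (frameOf c₁ c₂ i₂).det = -1 := by
    rw [frameOf, Matrix.det_transpose]
    change Matrix.det ![c₁, c₂, Pi.single i₂ 1] = 1 ∨ Matrix.det ![c₁, c₂, Pi.single i₂ 1] = -1
    rw [Matrix.det_fin_three]
    fin_cases i₀ <;> fin_cases i₁ <;> fin_cases i₂ <;> simp at h₀₁ h₀₂ h₁₂ hc₁ hc₂₀ hc₂₁ ⊢ <;>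
      simp [hc₁, hc₂₀, hc₂₁]
  rcases key with h | h
  · rw [h]; exact isUnit_one
  · rw [h]; exact isUnit_one.neg

/-- **Upper triangularity in an adapted frame**: if `R c₁ = a c₁` and `R c₂ = α c₁ + β c₂` then
`g⁻¹ R g` is upper triangular for the frame `g` with columns `c₁, c₂, e_{i₂}` (`det g` a unit). -/
theorem isUpper3_conj_frameOf (c₁ c₂ : Fin 3 → O) (i₂ : Fin 3) (hdet : IsUnit (frameOf c₁ c₂ i₂).det)
    (R : Matrix (Fin 3) (Fin 3) O) (a α β : O) (h₁ : R *ᵥ c₁ = a • c₁) (h₂ : R *ᵥ c₂ = α • c₁ + β • c₂) :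
    IsUpper3 ((frameOf c₁ c₂ i₂)⁻¹ * R * frameOf c₁ c₂ i₂) := by
  set g := frameOf c₁ c₂ i₂ with hg
  obtain ⟨hg0, hg1⟩ := frameOf_mulVec_single c₁ c₂ i₂
  have hinv : g⁻¹ * g = 1 := Matrix.nonsing_inv_mul g hdet
  have hginv₁ : g⁻¹ *ᵥ c₁ = Pi.single 0 1 := by
    rw [← hg0, Matrix.mulVec_mulVec, hinv, Matrix.one_mulVec]
  have hginv₂ : g⁻¹ *ᵥ c₂ = Pi.single 1 1 := by
    rw [← hg1, Matrix.mulVec_mulVec, hinv, Matrix.one_mulVec]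
  have hcol0 : (g⁻¹ * R * g) *ᵥ Pi.single 0 1 = a • Pi.single 0 1 := by
    rw [← Matrix.mulVec_mulVec, ← Matrix.mulVec_mulVec, hg0, h₁, Matrix.mulVec_smul, hginv₁]
  have hcol1 : (g⁻¹ * R * g) *ᵥ Pi.single 1 1 = α • Pi.single 0 1 + β • Pi.single 1 1 := by
    rw [← Matrix.mulVec_mulVec, ← Matrix.mulVec_mulVec, hg1, h₂, Matrix.mulVec_add, Matrix.mulVec_smul,
      Matrix.mulVec_smul, hginv₁, hginv₂]
  have e0 := fun i => congrFun hcol0 i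
  have e1 := fun i => congrFun hcol1 i
  simp only [Matrix.mulVec_single_one, Pi.smul_apply, Pi.add_apply, smul_eq_mul] at e0 e1
  refine ⟨?_, ?_, ?_⟩
  · simpa using e0 1
  · simpa using e0 2
  · simpa using e1 2

end Frame

/-! ### Transpose-inverse on `GL₃` and the antidiagonal involution -/

section Dual

variable {A : Type*} [CommRing A]

/-- The contragredient `u ↦ (u⁻¹)ᵀ` on `GL₃(A)`, a group homomorphism. -/
def trinv : GL (Fin 3) A →* GL (Fin 3) A where
  toFun u := ⟨(u⁻¹).valᵀ, u.valᵀ, by rw [← Matrix.transpose_mul, Units.mul_inv, Matrix.transpose_one],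
    by rw [← Matrix.transpose_mul, Units.inv_mul, Matrix.transpose_one]⟩
  map_one' := Units.ext (by simp)
  map_mul' u w := Units.ext (by simp [Matrix.transpose_mul, mul_inv_rev])

/-- `(trinv u).val = (u⁻¹)ᵀ`. -/
@[simp] theorem trinv_val (u : GL (Fin 3) A) : (trinv u).val = (u⁻¹).valᵀ := rfl

/-- `(trinv u)⁻¹.val = uᵀ`. -/
@[simp] theorem trinv_inv_val (u : GL (Fin 3) A) : ((trinv u)⁻¹).val = u.valᵀ := rfl

/-- `trinv` commutes with change of rings. -/
theorem map_trinv {C : Type*} [CommRing C] (φ : A →+* C) (u : GL (Fin 3) A) :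
    Matrix.GeneralLinearGroup.map φ (trinv u) = trinv (Matrix.GeneralLinearGroup.map φ u) :=
  Units.ext (by
    change ((u⁻¹).valᵀ).map φ = ((Matrix.GeneralLinearGroup.map φ u)⁻¹).valᵀ
    rw [Matrix.transpose_map, ← map_inv (Matrix.GeneralLinearGroup.map φ) u]
    rfl)

/-- The antidiagonal permutation matrix `w₀` (reversal of the basis), an involution in `GL₃(A)`. -/
def w₀ : GL (Fin 3) A :=
  ⟨Matrix.of ![![0, 0, 1], ![0, 1, 0], ![1, 0, 0]], Matrix.of ![![0, 0, 1], ![0, 1, 0], ![1, 0, 0]],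
    by ext i j; fin_cases i <;> fin_cases j <;> simp [Matrix.mul_apply, Fin.sum_univ_three],
    by ext i j; fin_cases i <;> fin_cases j <;> simp [Matrix.mul_apply, Fin.sum_univ_three]⟩

/-- `w₀⁻¹ = w₀`. -/
@[simp] theorem w₀_inv : (w₀ : GL (Fin 3) A)⁻¹ = w₀ := Units.ext rfl

/-- Entries of `w₀ M w₀`: reversal of both indices. -/
theorem w₀_conj_apply (M : Matrix (Fin 3) (Fin 3) A) (i j : Fin 3) :
    ((w₀ : GL (Fin 3) A).val * M * (w₀ : GL (Fin 3) A).val) i j = M (Fin.rev i) (Fin.rev j) := by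
  fin_cases i <;> fin_cases j <;>
    simp [w₀, Matrix.mul_apply, Matrix.vecMul, dotProduct, Fin.sum_univ_three, Fin.rev]

/-- `w₀` commutes with change of rings. -/
theorem map_w₀ {C : Type*} [CommRing C] (φ : A →+* C) : Matrix.GeneralLinearGroup.map φ (w₀ : GL (Fin 3) A) = w₀ :=
  Units.ext (by
    change (Matrix.of ![![0, 0, 1], ![0, 1, 0], ![1, 0, 0]] : Matrix (Fin 3) (Fin 3) A).map φ = _
    ext i j; fin_cases i <;> fin_cases j <;> simp [w₀])

/-- If `V` is upper triangular then so is `w₀ Vᵀ w₀`. -/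
theorem IsUpper3.w₀_transpose {V : Matrix (Fin 3) (Fin 3) A} (h : IsUpper3 V) :
    IsUpper3 ((w₀ : GL (Fin 3) A).val * Vᵀ * (w₀ : GL (Fin 3) A).val) := by
  obtain ⟨h10, h20, h21⟩ := h
  refine ⟨?_, ?_, ?_⟩ <;> rw [w₀_conj_apply, Matrix.transpose_apply] <;> simpa [Fin.rev]

/-- **The dual frame.**  If `g⁻¹ u g` is upper triangular (and invertible, over a field) then so is
`(g*)⁻¹ u* g*` for the contragredients `u* = (u⁻¹)ᵀ`, `g* = (g⁻¹)ᵀ w₀`; explicitly it is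
`w₀ ((g⁻¹ u g)⁻¹)ᵀ w₀`. -/
theorem dualFrame_conj {F : Type*} [Field F] (g u : GL (Fin 3) F) :
    ((trinv g * w₀)⁻¹ * trinv u * (trinv g * w₀)).val =
      (w₀ : GL (Fin 3) F).val * ((g⁻¹ * u * g)⁻¹).valᵀ * (w₀ : GL (Fin 3) F).val := by
  have : (trinv g * w₀)⁻¹ * trinv u * (trinv g * w₀) = w₀ * trinv (g⁻¹ * u * g) * w₀ := by
    rw [map_mul, map_mul, map_inv, mul_inv_rev, w₀_inv]; group
  rw [this, Units.val_mul, Units.val_mul, trinv_val]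

/-- Upper triangularity of the dual frame. -/
theorem isUpper3_dualFrame {F : Type*} [Field F] (g u : GL (Fin 3) F) (h : IsUpper3 (g⁻¹ * u * g).val) :
    IsUpper3 ((trinv g * w₀)⁻¹ * trinv u * (trinv g * w₀)).val := by
  rw [dualFrame_conj]
  refine IsUpper3.w₀_transpose ?_
  rw [Matrix.coe_units_inv]
  exact IsUpper3.inv h ((Matrix.isUnit_iff_isUnit_det _).mp (g⁻¹ * u * g).isUnit).ne_zero

/-- The diagonal of the inverse of an invertible upper-triangular matrix. -/
theorem IsUpper3.inv_apply_diag {F : Type*} [Field F] (U : GL (Fin 3) F) (h : IsUpper3 U.val) (i : Fin 3) :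
    (U⁻¹).val i i = (U.val i i)⁻¹ := by
  have hinv : IsUpper3 (U⁻¹).val := by
    rw [Matrix.coe_units_inv]
    exact IsUpper3.inv h ((Matrix.isUnit_iff_isUnit_det _).mp U.isUnit).ne_zero
  have e := IsUpper3.mul_apply_diag hinv h i
  rw [← Units.val_mul, inv_mul_cancel, Units.val_one, Matrix.one_apply_eq] at e
  exact eq_inv_of_mul_eq_one_left e.symm

/-- The diagonal of the dual frame: `((g*)⁻¹ u* g*)_{ii} = ((g⁻¹ u g)_{i' i'})⁻¹`, `i' = rev i`. -/
theorem dualFrame_diag {F : Type*} [Field F] (g u : GL (Fin 3) F) (h : IsUpper3 (g⁻¹ * u * g).val) (i : Fin 3) :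
    ((trinv g * w₀)⁻¹ * trinv u * (trinv g * w₀)).val i i = ((g⁻¹ * u * g).val (Fin.rev i) (Fin.rev i))⁻¹ := by
  rw [dualFrame_conj, w₀_conj_apply, Matrix.transpose_apply, IsUpper3.inv_apply_diag _ h]

end Dual

/-! ### `ℤ̄₃ ⊆ ℚ̄₃`, its residue field, and `𝒪₀ → ℤ̄₃` -/

section PadicInt

/-- Membership in `ℤ̄₃` is `‖x‖ ≤ 1`. -/
theorem mem_padicAlgClIntegers_iff (x : PadicAlgCl 3) : x ∈ padicAlgClIntegers 3 ↔ ‖x‖ ≤ 1 :=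
  padicAlgCl_mem_valuationSubring_iff 3 x

/-- The maximal ideal of `ℤ̄₃` is `‖x‖ < 1`. -/
theorem mem_maximalIdeal_padicAlgClIntegers_iff (x : padicAlgClIntegers 3) :
    x ∈ maximalIdeal (padicAlgClIntegers 3) ↔ ‖(x : PadicAlgCl 3)‖ < 1 :=
  mem_maximalIdeal_iff_norm_lt_one (mem_padicAlgClIntegers_iff) x

/-- The residue field of `ℤ̄₃` has characteristic `3`. -/
theorem charP_padicAlgClResidueField : CharP (padicAlgClResidueField 3) 3 := by
  refine (CharP.charP_iff_prime_eq_zero Nat.prime_three).mpr ?_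
  rw [← map_natCast (residue (padicAlgClIntegers 3)) 3, residue_eq_zero_iff, mem_maximalIdeal_padicAlgClIntegers_iff]
  change ‖((3 : ℕ) : PadicAlgCl 3)‖ < 1
  have h := Padic.norm_p (p := 3)
  have h' : ‖algebraMap ℚ_[3] (PadicAlgCl 3) ((3 : ℕ) : ℚ_[3])‖ = ‖((3 : ℕ) : ℚ_[3])‖ := norm_algebraMap' _ _
  rw [map_natCast] at h'
  push_cast at h h' ⊢
  rw [h', h]
  norm_num

/-- `𝔽₃ → ℤ̄₃/𝔪` (a `def`, turned on with `letI`). -/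
abbrev algebraZModPadicAlgClResidueField : Algebra (ZMod 3) (padicAlgClResidueField 3) :=
  haveI := charP_padicAlgClResidueField
  ZMod.algebra _ 3

variable (ι : PadicAlgCl 3 ≃+* ℂ) (e : K →+* ℂ)

/-- `𝒪₀ → ℤ̄₃`. -/
def jbar : O₀ ι e →+* padicAlgClIntegers 3 :=
  (j₀ ι e).codRestrict (padicAlgClIntegers 3).toSubring fun x => (mem_padicAlgClIntegers_iff _).mpr (norm_j₀_le_one ι e x)

/-- `jbar` on underlying elements. -/
@[simp] theorem coe_jbar (x : O₀ ι e) : ((jbar ι e x : padicAlgClIntegers 3) : PadicAlgCl 3) = j₀ ι e x := rfl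

/-- The two residue maps agree on `𝒪₀`: `(x mod 𝔪̄) = (x mod 𝔪₀)` read in `ℤ̄₃/𝔪̄ ⊇ 𝔽₃`. -/
theorem residue_jbar (x : O₀ ι e) :
    letI := algebraZModPadicAlgClResidueField
    residue (padicAlgClIntegers 3) (jbar ι e x) =
      algebraMap (ZMod 3) (padicAlgClResidueField 3) (algebraMap (O₀ ι e) (ZMod 3) x) := by
  letI := algebraZModPadicAlgClResidueField
  obtain ⟨n, hn⟩ := exists_nat_sub_mem_maximalIdeal ι e x
  have h1 : residue (padicAlgClIntegers 3) (jbar ι e (x - n)) = 0 := by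
    rw [residue_eq_zero_iff, mem_maximalIdeal_padicAlgClIntegers_iff, coe_jbar]
    exact (mem_maximalIdeal_O₀_iff ι e _).mp hn
  have h2 : algebraMap (O₀ ι e) (ZMod 3) (x - n) = 0 := by
    rw [← RingHom.mem_ker, ker_algebraMap_O₀_ZMod]; exact hn
  rw [map_sub (jbar ι e)] at h1
  rw [map_sub (residue (padicAlgClIntegers 3)), sub_eq_zero, map_natCast, map_natCast] at h1
  rw [map_sub, sub_eq_zero, map_natCast] at h2
  rw [h1, h2, map_natCast]

/-- A finite ultrametric sum of terms of norm `≤ 1` has norm `≤ 1`. -/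
theorem norm_sum_fin_three_le_one (a : Fin 3 → PadicAlgCl 3) (h : ∀ i, ‖a i‖ ≤ 1) : ‖∑ i, a i‖ ≤ 1 := by
  rw [Fin.sum_univ_three]
  refine le_trans (IsUltrametricDist.norm_add_le_max _ _) (max_le (le_trans (IsUltrametricDist.norm_add_le_max _ _)
    (max_le (h 0) (h 1))) (h 2))

end PadicInt

/-! ### General matrix facts -/

section MatrixFacts

variable {F : Type*} [CommRing F]

/-- `scalar a *ᵥ v = a • v`. -/
theorem scalar_mulVec (a : F) (v : Fin 3 → F) : Matrix.scalar (Fin 3) a *ᵥ v = a • v := by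
  ext i
  simp [Matrix.scalar_apply, Matrix.mulVec_diagonal]

/-- An upper-triangular matrix in the tree's sense is block triangular for `id`. -/
theorem IsUpper3.blockTriangular {M : Matrix (Fin 3) (Fin 3) F} (h : IsUpper3 M) : M.BlockTriangular id := by
  obtain ⟨h10, h20, h21⟩ := h
  intro i j hij
  fin_cases i <;> fin_cases j <;> simp at hij <;> assumption

/-- The first column of `g` is a common eigenvector when `g⁻¹ u g` is upper triangular, with eigenvalue
the `(0,0)` entry. -/
theorem mulVec_col_zero_of_isUpper3 {F : Type*} [Field F] (g u : GL (Fin 3) F) (hT : IsUpper3 (g⁻¹ * u * g).val) :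
    u.val *ᵥ (g.val *ᵥ Pi.single 0 1) = (g⁻¹ * u * g).val 0 0 • (g.val *ᵥ Pi.single 0 1) := by
  set T := g⁻¹ * u * g with hT'
  obtain ⟨h10, h20, -⟩ := hT
  have hcol : T.val *ᵥ Pi.single 0 1 = T.val 0 0 • Pi.single 0 1 := by
    ext i
    rw [Matrix.mulVec_single_one]
    fin_cases i
    · simp
    · simpa using h10
    · simpa using h20
  have hug : u * g = g * T := by
    rw [hT', ← mul_assoc, ← mul_assoc, mul_inv_cancel, one_mul]
  rw [Matrix.mulVec_mulVec, ← Units.val_mul, hug, Units.val_mul, ← Matrix.mulVec_mulVec, hcol, Matrix.mulVec_smul]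

/-- If `a × b = 0` and `b i₀ = 1` then `a = a i₀ • b`. -/
theorem eq_smul_of_cross_eq_zero {F : Type*} [CommRing F] (a b : Fin 3 → F) (i₀ : Fin 3) (hb : b i₀ = 1)
    (h : crossProduct a b = 0) : a = a i₀ • b := by
  have h0 := congrFun h 0
  have h1 := congrFun h 1
  have h2 := congrFun h 2
  simp only [cross_apply, Matrix.cons_val_zero, Matrix.cons_val_one, Pi.zero_apply, Matrix.cons_val] at h0 h1 h2
  ext i
  simp only [Pi.smul_apply, smul_eq_mul]
  fin_cases i₀
  · simp only [Fin.zero_eta] at hb ⊢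
    rw [hb] at h1 h2
    fin_cases i
    · simp [hb]
    · simp; linear_combination (exp := 1) -h2
    · simp; linear_combination (exp := 1) h1
  · simp only [Fin.mk_one] at hb ⊢
    rw [hb] at h0 h2
    fin_cases i
    · simp; linear_combination (exp := 1) h2
    · simp [hb]
    · simp; linear_combination (exp := 1) -h0
  · simp only [Fin.reduceFinMk] at hb ⊢
    rw [hb] at h0 h1
    fin_cases i
    · simp; linear_combination (exp := 1) -h1
    · simp; linear_combination (exp := 1) h0
    · simp [hb]

end MatrixFacts

/-- **Summary (registered helper goal of `stub_point`)**: upper triangularity in an adapted frame. -/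
theorem pointBorelFrame_isUpper3 : ∀ {O : Type} [CommRing O] (c₁ c₂ : Fin 3 → O) (i₂ : Fin 3), IsUnit (frameOf c₁ c₂ i₂).det → ∀ (R : Matrix (Fin 3) (Fin 3) O) (a α β : O), R *ᵥ c₁ = a • c₁ → R *ᵥ c₂ = α • c₁ + β • c₂ → IsUpper3 ((frameOf c₁ c₂ i₂)⁻¹ * R * frameOf c₁ c₂ i₂) :=
  fun c₁ c₂ i₂ h R a α β h₁ h₂ => isUpper3_conj_frameOf c₁ c₂ i₂ h R a α β h₁ h₂

end

end Summit.Langlands.Langlands.Cruxes.MuOrdinaryFamilyRT.FreeSeedSmoothRt
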